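import Summits.BirchSwinnertonDyer.BirchSwinnertonDyer.Theorems.RamifiedHeegnerPairLeafPartnerOrdersUAdjoint
import Summits.BirchSwinnertonDyer.BirchSwinnertonDyer.Theorems.RamifiedHeegnerPairLeafPartnerOrdersUColumnSums
import Summits.BirchSwinnertonDyer.BirchSwinnertonDyer.Theorems.RamifiedHeegnerPairLeafPartnerOrdersHeckeTwist
import Summits.BirchSwinnertonDyer.BirchSwinnertonDyer.Theorems.RamifiedHeegnerPairLeafPartnerOrdersCanonicalGenerators
import HarnessLib

/-!
# Route `RamifiedHeegnerPair`, crux U₁ `LeafRankOneUpperAtThree` (stmt-BirchSwinnertonDyer-26022), line `partnerdescent` —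
# the Hecke–Atkin–Lehner twist (HT) from the tree, part 8 (final): the Atkin–Lehner involution `W_{N⁺}` of `Cls O`, the twisted
# adjointness `U_ℓᵀ (D_w W) = (D_w W) U_ℓ` for EVERY `ℓ ∣ N⁺`, and **(HT) = the first conjunct of the stub HECKE-MODULE, PROVED**

HONEST FRAMING. Theorems only; helper file (`--supports stmt-BirchSwinnertonDyer-26022`); assembly of parts 1–7 with ‹…LeafPartnerOrdersHeckeTwist›
`heckeTwist_of_involution` (g64); no named fact, no `sorry`; nothing booked; BSD is proved for no curve. The stub text (HT)
`Partnerdescent.LeafHeckeTwistAtThree` of skeleton v10 is restated VERBATIM as the type of `leafHeckeTwistAtThree` below (the Cruxes work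
file is not importable); the next skeleton replaces `stub_leafHeckeModuleInputs.1` by it. Lead prover bsd-line-rhp-p2 g65, 2026-08-31.

WHAT.
* `exists_atkinLehnerInvolution` — an involution `σ` of `Cls O` (the composite `W_{N⁺}` of the `S.wPlus q`, `q ∣ N⁺`) preserving all Brandt
  matrices and weights with `w_c (U_ℓ)_{c i} = w_i (U_ℓ)_{σ i, σ c}` for EVERY prime `ℓ ∣ N⁺` (parts 7: `U_ℓ† = W_{ℓ⁺} U_ℓ W_{ℓ⁺}` and
  `U_ℓ` commutes with `W_{q⁺}`, `q ≠ ℓ`);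
* `uMatrix_transpose_mul_twist` — the matrix form `U_ℓᵀ · (D_w P_σ) = (D_w P_σ) · U_ℓ` (= `huadj` of `heckeTwist_of_involution`);
* `heckeTwist` — (HT) for every Brandt setup; `leafHeckeTwistAtThree` — (HT) with the binders of the stub, VERBATIM.
[cite: Mazur1977, II §15] [cite: WZhang2014, §3.9 p. 214] [cite: BertoliniDarmon1996, §1.5] [cite: Gross1987, §1–§2]
-/

set_option linter.dupNamespace false
set_option autoImplicit false

noncomputable section

namespace Summit.BirchSwinnertonDyer.BirchSwinnertonDyer.Theorems.LeafPartnerOrders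

open scoped Pointwise Matrix
open Matrix Literature.NumberTheory.Automorphic Literature.NumberTheory.Automorphic.Brandt Literature.NumberTheory.EllipticCurves

variable {Nplus Nminus : ℕ} (S : XiSetup Nplus Nminus)

/-! ### The Atkin–Lehner involution `W_{N⁺}` as a composite of the `W_{q⁺}` -/

/-- **Composite Atkin–Lehner involutions.** For a list `L` of distinct primes not dividing `N⁻` there is an involution `σ_L` of `Cls O` (the
composite of the `W_{q⁺}`, `q ∈ L`) preserving Brandt matrices and weights, commuting with every `W_{q⁺}`, such that `(U_ℓ)_{σ i, σ c} =
(U_ℓ)_{W_{ℓ⁺} i, W_{ℓ⁺} c}` for `ℓ ∈ L` and `(U_ℓ)_{σ i, σ c} = (U_ℓ)_{i c}` for primes `ℓ ∉ L` (stated as an existence: no definition is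
introduced). [cite: BertoliniDarmon1996, §1.5] [cite: VignerasLNM800, Ch. III §5 exercice 5.8 (d)] -/
theorem exists_atkinLehnerInvolution_of_list (L : List ℕ) (hL : ∀ q ∈ L, q.Prime ∧ ¬ q ∣ Nminus) (hnd : L.Nodup) :
    ∃ σ : ClassSet S.O → ClassSet S.O, Function.Involutive σ ∧
      (∀ n c d, Brandt.matrix S.O n (σ c) (σ d) = Brandt.matrix S.O n c d) ∧
      (∀ c, weight S.O (σ c) = weight S.O c) ∧
      (∀ (q : ℕ) (hq : q.Prime) (hqm : ¬ q ∣ Nminus) (c : ClassSet S.O),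
        σ (@XiSetup.wPlus _ _ S q ⟨hq⟩ hqm c) = @XiSetup.wPlus _ _ S q ⟨hq⟩ hqm (σ c)) ∧
      (∀ (ℓ : ℕ) (hℓ : ℓ.Prime) (hℓm : ¬ ℓ ∣ Nminus), ℓ ∈ L → ∀ i c,
        S.uMatrix ℓ (σ i) (σ c) = S.uMatrix ℓ (@XiSetup.wPlus _ _ S ℓ ⟨hℓ⟩ hℓm i) (@XiSetup.wPlus _ _ S ℓ ⟨hℓ⟩ hℓm c)) ∧
      (∀ ℓ : ℕ, ℓ.Prime → ℓ ∉ L → ∀ i c, S.uMatrix ℓ (σ i) (σ c) = S.uMatrix ℓ i c) := by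
  induction L with
  | nil =>
    exact ⟨id, fun _ ↦ rfl, fun _ _ _ ↦ rfl, fun _ ↦ rfl, fun _ _ _ _ ↦ rfl, fun _ _ _ h ↦ (List.not_mem_nil h).elim,
      fun _ _ _ _ _ ↦ rfl⟩
  | cons q L ih =>
    obtain ⟨hq, hqm⟩ := hL q List.mem_cons_self
    have hqL : q ∉ L := (List.nodup_cons.mp hnd).1
    obtain ⟨τ, hτ, hτT, hτw, hτc, hτin, hτout⟩ := ih (fun r hr ↦ hL r (List.mem_cons_of_mem q hr)) (List.nodup_cons.mp hnd).2
    haveI : Fact q.Prime := ⟨hq⟩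
    refine ⟨fun c ↦ S.wPlus q hqm (τ c), fun c ↦ ?_, fun n c d ↦ ?_, fun c ↦ ?_, fun q' hq' hqm' c ↦ ?_,
      fun ℓ hℓ hℓm hmem i c ↦ ?_, fun ℓ hℓ hmem i c ↦ ?_⟩
    · -- involutive
      show S.wPlus q hqm (τ (S.wPlus q hqm (τ c))) = c
      rw [hτc q hq hqm, S.wPlus_wPlus, hτ]
    · rw [S.matrix_apply_wPlus_wPlus, hτT]
    · rw [S.weight_wPlus, hτw]
    · haveI : Fact q'.Prime := ⟨hq'⟩
      show S.wPlus q hqm (τ (S.wPlus q' hqm' c)) = S.wPlus q' hqm' (S.wPlus q hqm (τ c))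
      rw [hτc q' hq' hqm', S.wPlus_comm]
    · haveI : Fact ℓ.Prime := ⟨hℓ⟩
      rcases List.mem_cons.mp hmem with rfl | hmemL
      · -- `ℓ = q`: move `W_{q⁺}` inside, then `τ` is invisible to `U_q`
        show S.uMatrix ℓ (S.wPlus ℓ hqm (τ i)) (S.wPlus ℓ hqm (τ c)) = _
        rw [← hτc ℓ hℓ hqm, ← hτc ℓ hℓ hqm, hτout ℓ hℓ hqL]
      · have hne : q ≠ ℓ := fun h ↦ hqL (h ▸ hmemL)
        show S.uMatrix ℓ (S.wPlus q hqm (τ i)) (S.wPlus q hqm (τ c)) = _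
        rw [uMatrix_wPlus_wPlus_of_ne S hqm hne, hτin ℓ hℓ hℓm hmemL]
    · haveI : Fact ℓ.Prime := ⟨hℓ⟩
      have hne : q ≠ ℓ := fun h ↦ hmem (h ▸ List.mem_cons_self)
      have hmemL : ℓ ∉ L := fun h ↦ hmem (List.mem_cons_of_mem q h)
      show S.uMatrix ℓ (S.wPlus q hqm (τ i)) (S.wPlus q hqm (τ c)) = _
      rw [uMatrix_wPlus_wPlus_of_ne S hqm hne, hτout ℓ hℓ hmemL]

/-- **The Atkin–Lehner involution `W_{N⁺}` of `Cls O` makes every `U_ℓ` twisted-self-adjoint.** There is an involution `σ` of `Cls O`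
preserving the Brandt matrices and the weights with `w_c (U_ℓ)_{c i} = w_i (U_ℓ)_{σ i, σ c}` for EVERY prime `ℓ ∣ N⁺` and all classes
`i, c`: the adjoint of `U_ℓ` for Gross's pairing `⟨e_c, e_c⟩ = w_c` is `σ U_ℓ σ` (Mazur 1977 II §15's `w`-twisted pairing; W. Zhang 2014 §3.9).
[cite: Mazur1977, II §15] [cite: WZhang2014, §3.9 p. 214] -/
theorem exists_atkinLehnerInvolution :
    ∃ σ : ClassSet S.O → ClassSet S.O, Function.Involutive σ ∧
      (∀ n c d, Brandt.matrix S.O n (σ c) (σ d) = Brandt.matrix S.O n c d) ∧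
      (∀ c, weight S.O (σ c) = weight S.O c) ∧
      (∀ ℓ : ℕ, ℓ.Prime → ℓ ∣ Nplus → ∀ i c,
        (weight S.O c : ℤ) * S.uMatrix ℓ c i = (weight S.O i : ℤ) * S.uMatrix ℓ (σ i) (σ c)) := by
  classical
  set L := Nplus.primeFactors.toList with hLdef
  have hL : ∀ q ∈ L, q.Prime ∧ ¬ q ∣ Nminus := fun q hq ↦ by
    rw [hLdef, Finset.mem_toList, Nat.mem_primeFactors] at hq
    exact ⟨hq.1, fun h ↦ hq.1.one_lt.ne' (Nat.eq_one_of_dvd_coprimes S.coprime hq.2.1 h)⟩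
  obtain ⟨σ, hσ, hT, hw, -, hin, -⟩ := exists_atkinLehnerInvolution_of_list S L hL (Finset.nodup_toList _)
  refine ⟨σ, hσ, hT, hw, fun ℓ hℓ hℓN i c ↦ ?_⟩
  haveI : Fact ℓ.Prime := ⟨hℓ⟩
  have hℓm : ¬ ℓ ∣ Nminus := fun h ↦ hℓ.one_lt.ne' (Nat.eq_one_of_dvd_coprimes S.coprime hℓN h)
  have hmem : ℓ ∈ L := by rw [hLdef, Finset.mem_toList, Nat.mem_primeFactors]; exact ⟨hℓ, hℓN, S.nplus_ne_zero⟩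
  rw [hin ℓ hℓ hℓm hmem, weight_mul_uMatrix_eq_wPlus S hℓm hℓN]

/-! ### The matrix form of the twisted adjointness -/

/-- **`U_ℓᵀ · (D_w P_σ) = (D_w P_σ) · U_ℓ`** from `w_c (U_ℓ)_{c i} = w_i (U_ℓ)_{σ i, σ c}` (`P_σ v = v ∘ σ`; entry `(i, b)`
of both sides is `w_{σ b} (U_ℓ)_{σ b, i} = w_i (U_ℓ)_{σ i, b}`). This is VERBATIM the hypothesis `huadj` of `heckeTwist_of_involution`.
[cite: Mazur1977, II §15] [cite: Gross1987, §1–§2] -/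
theorem uMatrix_transpose_mul_twist [Fintype (ClassSet S.O)] [DecidableEq (ClassSet S.O)] {σ : ClassSet S.O → ClassSet S.O}
    (hσ : Function.Involutive σ) (ℓ : ℕ)
    (hadj : ∀ i c, (weight S.O c : ℤ) * S.uMatrix ℓ c i = (weight S.O i : ℤ) * S.uMatrix ℓ (σ i) (σ c)) :
    (S.uMatrix ℓ)ᵀ * (Matrix.diagonal (fun c ↦ (weight S.O c : ℤ)) * (hσ.toPerm σ).permMatrix ℤ) =
      (Matrix.diagonal (fun c ↦ (weight S.O c : ℤ)) * (hσ.toPerm σ).permMatrix ℤ) * S.uMatrix ℓ := by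
  have hsymm : ∀ b, (hσ.toPerm σ).symm b = σ b := fun _ ↦ rfl
  ext i b
  rw [← Matrix.mul_assoc, Equiv.Perm.permMatrix, PEquiv.mul_toMatrix_toPEquiv, Matrix.submatrix_apply, id, hsymm,
    Matrix.mul_diagonal, Matrix.transpose_apply, Matrix.mul_assoc, PEquiv.toMatrix_toPEquiv_mul, Matrix.diagonal_mul,
    Matrix.submatrix_apply, id]
  show S.uMatrix ℓ (σ b) i * (weight S.O (σ b) : ℤ) = (weight S.O i : ℤ) * S.uMatrix ℓ ((hσ.toPerm σ) i) b
  rw [show (hσ.toPerm σ) i = σ i from rfl, mul_comm, hadj i (σ b), hσ b]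

/-! ### (HT) -/

/-- **(HT) for every Brandt setup.** For `S` of type `(N⁺, N⁻)` there are integral `W₁, W₂` on `ℤ^{Cls O}` — both equal to the permutation
matrix of the Atkin–Lehner involution `W_{N⁺}` — with `W₁ W₂ = W₂ W₁ = 1`, degree-preserving, commuting with the Brandt matrices at the good
primes, such that every canonical Hecke generator `S.heckeAt q` (`U_q` at `q ∣ N⁺`, `T(q)` otherwise) is self-adjoint for Gross's pairing
twisted by `W₁` — `(heckeAt q)ᵀ · (D_w W₁) = (D_w W₁) · heckeAt q` — and preserves degree zero: `heckeTwist_of_involution` (g64) with its two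
print inputs `huadj`, `hudeg` DISCHARGED by parts 1–7. [cite: Mazur1977, II §15] [cite: WZhang2014, §3.9 p. 214] [cite: Gross1987, §1–§2] -/
theorem heckeTwist [Fintype (ClassSet S.O)] [DecidableEq (ClassSet S.O)] :
    ∃ (W₁ W₂ : Matrix (ClassSet S.O) (ClassSet S.O) ℤ),
      W₁ * W₂ = 1 ∧ W₂ * W₁ = 1 ∧
      (∀ v : ClassSet S.O → ℤ, ∑ c, v c = 0 → ∑ c, (W₁ *ᵥ v) c = 0) ∧
      (∀ v : ClassSet S.O → ℤ, ∑ c, v c = 0 → ∑ c, (W₂ *ᵥ v) c = 0) ∧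
      (∀ q : ℕ, q.Prime → ¬ q ∣ Nplus * Nminus → W₁ * Brandt.matrix S.O q = Brandt.matrix S.O q * W₁) ∧
      (∀ q : ℕ, q.Prime → (S.heckeAt q)ᵀ * (Matrix.diagonal (fun c ↦ (weight S.O c : ℤ)) * W₁) =
        (Matrix.diagonal (fun c ↦ (weight S.O c : ℤ)) * W₁) * S.heckeAt q) ∧
      (∀ q : ℕ, q.Prime → ∀ v : ClassSet S.O → ℤ, ∑ c, v c = 0 → ∑ c, (S.heckeAt q *ᵥ v) c = 0) := by
  obtain ⟨σ, hσ, hT, -, hadj⟩ := exists_atkinLehnerInvolution S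
  exact heckeTwist_of_involution S hσ hT (fun q hq hqN ↦ uMatrix_transpose_mul_twist S hσ q (hadj q hq hqN))
    (fun q hq hqN v hv ↦ sum_uMatrix_mulVec_eq_zero S hq hqN v hv)

/-- **(HT) — the first conjunct `Partnerdescent.LeafHeckeTwistAtThree` of the stub HECKE-MODULE of skeleton v10, VERBATIM, PROVED.** For the
binders of (G3♭ᶜ) up to the Brandt setup `S` of type `(pM, d)` (the curve, the Shimura data and the hypotheses at `3` and `d` are not used):
the Hecke–Atkin–Lehner twist exists. No print input remains in (HT). [cite: Mazur1977, II §15] [cite: WZhang2014, §3.9 p. 214] -/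
theorem leafHeckeTwistAtThree :
    ∀ {N D M p d : ℕ}, p.Prime → D = p * d → IsAdmissibleFactorization N D M →
    ∀ (X : ShimuraCurveData D M) (W : WeierstrassCurve ℚ) [W.IsElliptic] [W.IsGloballyMinimal],
      W.conductorNorm ℤ = N → ¬ 3 ∣ N → W.HasIrreducibleModPGaloisRep 3 →
    ∀ [Fact d.Prime], d ≠ p → W.HasSplitMultiplicativeReductionAtPrime d →
    ∀ (S : Brandt.XiSetup (p * M) d) [Fintype (Brandt.ClassSet S.O)] [DecidableEq (Brandt.ClassSet S.O)],
    ∃ (W₁ W₂ : Matrix (Brandt.ClassSet S.O) (Brandt.ClassSet S.O) ℤ),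
      W₁ * W₂ = 1 ∧ W₂ * W₁ = 1 ∧
      (∀ v : Brandt.ClassSet S.O → ℤ, ∑ c, v c = 0 → ∑ c, (W₁ *ᵥ v) c = 0) ∧
      (∀ v : Brandt.ClassSet S.O → ℤ, ∑ c, v c = 0 → ∑ c, (W₂ *ᵥ v) c = 0) ∧
      (∀ q : ℕ, q.Prime → ¬ q ∣ p * M * d → W₁ * Brandt.matrix S.O q = Brandt.matrix S.O q * W₁) ∧
      (∀ q : ℕ, q.Prime → (S.heckeAt q)ᵀ * (Matrix.diagonal (fun c ↦ (Brandt.weight S.O c : ℤ)) * W₁) =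
        (Matrix.diagonal (fun c ↦ (Brandt.weight S.O c : ℤ)) * W₁) * S.heckeAt q) ∧
      (∀ q : ℕ, q.Prime → ∀ v : Brandt.ClassSet S.O → ℤ, ∑ c, v c = 0 → ∑ c, (S.heckeAt q *ᵥ v) c = 0) :=
  fun _ _ _ _ _ _ _ _ _ _ _ _ _ S _ _ ↦ heckeTwist S

end Summit.BirchSwinnertonDyer.BirchSwinnertonDyer.Theorems.LeafPartnerOrders

end
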